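import Summits.RiemannHypothesis.RiemannHypothesis.Theorems.WeilTwoPrimeDeflE25EDef
import Summits.RiemannHypothesis.RiemannHypothesis.Theorems.WeilTwoPrimeDeflE25EDataPE33
import Literature.NumberTheory.LFunctions.WeilBlockRowsR
import HarnessLib

/-!
# Even-sector deflated two-prime certificate E25E: the materialized even block agrees with `P_r + Σ μ ĉ ĉᵀ`, rows 20–29

`WeilCert.checkPmRowG` for certificate E25E (even block), by `decide +kernel`. Pure proof file; nothing is asserted.
-/

set_option linter.dupNamespace false

noncomputable section

namespace Summit.RiemannHypothesis.RiemannHypothesis.Theorems.EvenWinsBeyondArch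

open Literature.NumberTheory.LFunctions

set_option maxHeartbeats 0 in
/-- Row 20 of the materialized even block is row 20 of `P_r + Σ μ ĉ ĉᵀ` (certificate E25E). [folklore] -/
theorem checkPmRowG0_20_weilCertDeflE25E : weilCertDeflE25EBase.checkPmRowG weilCertDeflE25EP weilCertDeflE25EPmE 0 20 = true := by
  decide +kernel

set_option maxHeartbeats 0 in
/-- Row 21 of the materialized even block is row 21 of `P_r + Σ μ ĉ ĉᵀ` (certificate E25E). [folklore] -/
theorem checkPmRowG0_21_weilCertDeflE25E : weilCertDeflE25EBase.checkPmRowG weilCertDeflE25EP weilCertDeflE25EPmE 0 21 = true := by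
  decide +kernel

set_option maxHeartbeats 0 in
/-- Row 22 of the materialized even block is row 22 of `P_r + Σ μ ĉ ĉᵀ` (certificate E25E). [folklore] -/
theorem checkPmRowG0_22_weilCertDeflE25E : weilCertDeflE25EBase.checkPmRowG weilCertDeflE25EP weilCertDeflE25EPmE 0 22 = true := by
  decide +kernel

set_option maxHeartbeats 0 in
/-- Row 23 of the materialized even block is row 23 of `P_r + Σ μ ĉ ĉᵀ` (certificate E25E). [folklore] -/
theorem checkPmRowG0_23_weilCertDeflE25E : weilCertDeflE25EBase.checkPmRowG weilCertDeflE25EP weilCertDeflE25EPmE 0 23 = true := by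
  decide +kernel

set_option maxHeartbeats 0 in
/-- Row 24 of the materialized even block is row 24 of `P_r + Σ μ ĉ ĉᵀ` (certificate E25E). [folklore] -/
theorem checkPmRowG0_24_weilCertDeflE25E : weilCertDeflE25EBase.checkPmRowG weilCertDeflE25EP weilCertDeflE25EPmE 0 24 = true := by
  decide +kernel

set_option maxHeartbeats 0 in
/-- Row 25 of the materialized even block is row 25 of `P_r + Σ μ ĉ ĉᵀ` (certificate E25E). [folklore] -/
theorem checkPmRowG0_25_weilCertDeflE25E : weilCertDeflE25EBase.checkPmRowG weilCertDeflE25EP weilCertDeflE25EPmE 0 25 = true := by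
  decide +kernel

set_option maxHeartbeats 0 in
/-- Row 26 of the materialized even block is row 26 of `P_r + Σ μ ĉ ĉᵀ` (certificate E25E). [folklore] -/
theorem checkPmRowG0_26_weilCertDeflE25E : weilCertDeflE25EBase.checkPmRowG weilCertDeflE25EP weilCertDeflE25EPmE 0 26 = true := by
  decide +kernel

set_option maxHeartbeats 0 in
/-- Row 27 of the materialized even block is row 27 of `P_r + Σ μ ĉ ĉᵀ` (certificate E25E). [folklore] -/
theorem checkPmRowG0_27_weilCertDeflE25E : weilCertDeflE25EBase.checkPmRowG weilCertDeflE25EP weilCertDeflE25EPmE 0 27 = true := by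
  decide +kernel

set_option maxHeartbeats 0 in
/-- Row 28 of the materialized even block is row 28 of `P_r + Σ μ ĉ ĉᵀ` (certificate E25E). [folklore] -/
theorem checkPmRowG0_28_weilCertDeflE25E : weilCertDeflE25EBase.checkPmRowG weilCertDeflE25EP weilCertDeflE25EPmE 0 28 = true := by
  decide +kernel

set_option maxHeartbeats 0 in
/-- Row 29 of the materialized even block is row 29 of `P_r + Σ μ ĉ ĉᵀ` (certificate E25E). [folklore] -/
theorem checkPmRowG0_29_weilCertDeflE25E : weilCertDeflE25EBase.checkPmRowG weilCertDeflE25EP weilCertDeflE25EPmE 0 29 = true := by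
  decide +kernel


end Summit.RiemannHypothesis.RiemannHypothesis.Theorems.EvenWinsBeyondArch
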